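import Literature.NumberTheory.LFunctions.FordRowCheck
import Literature.NumberTheory.LFunctions.ChebyshevSylvesterPrimeWindows
import HarnessLib

/-!
# Rows of Ford's Table 6.1, certified: the prime windows (`η = 23/20`) and the final bound

Topic `Literature/NumberTheory/LFunctions`. Pure proof file: the two prime-window hypotheses of
`FordVK.row_of_chain` are discharged unconditionally from the Chebyshev–Sylvester bounds
(`exists_prime_Icc_sylvester`, `Sylvester.card_primes_window_ge`), and `FordVK.row_const` turns a
successful run of the kernel checker `FordVK.rowCheck C k n₀ V l` (`FordRowCheck.lean`,
`rowCheck_sound`) into Ford's Theorem 2 with constant `C` on the row `N^{k-1} ≤ t ≤ N^k`: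
`‖∑_{N<n≤R} (n+u)^{-it}‖ ≤ C · N^{1 - (log N)²/(133.66 log² t)}` (`C = 12` for `k ≤ 84`, `13` for
`85 ≤ k ≤ 87`).

## References

* K. Ford, Proc. London Math. Soc. (3) 85 (2002), 565–633; arXiv:1910.08209: Lemma 6.8 and
  Table 6.1 (there `C ≤ 9.463`; here `12`–`13`, with `η = 23/20` in place of Rosser–Schoenfeld's `53/47`).
  [Ford2002]
-/

noncomputable section

open Finset

namespace Literature.NumberTheory.LFunctions
namespace FordVK

open scoped Chebyshev

/-- `x ↦ x / log(cx)` is non-decreasing for `cx ≥ e`. [folklore] -/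
theorem div_log_mono {c x y : ℝ} (hc : 0 < c) (hx : Real.exp 1 ≤ c * x) (hxy : x ≤ y) :
    x / Real.log (c * x) ≤ y / Real.log (c * y) := by
  have hx0 : 0 < x := by
    have := Real.exp_pos 1; nlinarith
  have hy0 : 0 < y := lt_of_lt_of_le hx0 hxy
  have hlx : 1 ≤ Real.log (c * x) := by
    rw [← Real.log_exp 1]; exact Real.log_le_log (Real.exp_pos 1) hx
  have hly : Real.log (c * x) ≤ Real.log (c * y) := Real.log_le_log (by positivity) (by nlinarith)
  have hlx0 : 0 < Real.log (c * x) := by linarith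
  have hly0 : 0 < Real.log (c * y) := by linarith
  rw [div_le_div_iff₀ hlx0 hly0]
  -- `x log(cy) ≤ y log(cx)`: `log(cy) = log(cx) + log(y/x) ≤ log(cx) + (y/x - 1) ≤ log(cx) · (y/x)`… use `log(y/x) ≤ y/x - 1`
  have h1 : Real.log (c * y) = Real.log (c * x) + Real.log (y / x) := by
    rw [← Real.log_mul (by positivity) (by positivity)]; congr 1; field_simp
  have h2 : Real.log (y / x) ≤ y / x - 1 := Real.log_le_sub_one_of_pos (by positivity)
  have h3 : x * Real.log (y / x) ≤ y - x := by
    have := mul_le_mul_of_nonneg_left h2 hx0.le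
    rwa [show x * (y / x - 1) = y - x by field_simp] at this
  calc x * Real.log (c * y) = x * Real.log (c * x) + x * Real.log (y / x) := by rw [h1]; ring
    _ ≤ x * Real.log (c * x) + (y - x) := by linarith
    _ ≤ x * Real.log (c * x) + (y - x) * Real.log (c * x) := by nlinarith
    _ = y * Real.log (c * x) := by ring

/-- The `V`-step windows: if `V ≥ 10⁸` and `V/(200 log(1.15 V)) ≥ k³`, then every `(x, (23/20)x]`
with `x ≥ V` contains a set of exactly `k³` primes.
[cite: Sylvester1892, pp. 87–120 (scheme [1,6,70;2,3,5,7,210])] -/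
theorem hwinV_sylvester {k : ℕ} {V : ℝ} (hV : 100000000 ≤ V)
    (hVk : (k : ℝ) ^ 3 ≤ V / (200 * Real.log (23 / 20 * V))) (x : ℝ) (hx : V ≤ x) :
    ∃ Ps : Finset ℕ, Ps.card = k ^ 3 ∧ ∀ p ∈ Ps, p.Prime ∧ x < p ∧ (p : ℝ) ≤ 23 / 20 * x := by
  have hx8 : 100000000 ≤ x := hV.trans hx
  have hx0 : 0 < x := by linarith
  have hcard := Sylvester.card_primes_window_ge hx8
  have hmono := div_log_mono (c := 23 / 20) (x := V) (y := x) (by norm_num)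
    (by have := Real.exp_one_lt_d9; nlinarith) hx
  have hk3 : ((k ^ 3 : ℕ) : ℝ) ≤ (((Ioc ⌊x⌋₊ ⌊23 / 20 * x⌋₊).filter Nat.Prime).card : ℝ) := by
    push_cast
    calc (k : ℝ) ^ 3 ≤ V / (200 * Real.log (23 / 20 * V)) := hVk
      _ = V / Real.log (23 / 20 * V) / 200 := by ring
      _ ≤ x / Real.log (23 / 20 * x) / 200 := by gcongr
      _ = x / (200 * Real.log (23 / 20 * x)) := by ring
      _ ≤ _ := hcard
  have hk3' : k ^ 3 ≤ ((Ioc ⌊x⌋₊ ⌊23 / 20 * x⌋₊).filter Nat.Prime).card := by exact_mod_cast hk3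
  obtain ⟨Ps, hsub, hPs⟩ := Finset.exists_subset_card_eq hk3'
  refine ⟨Ps, hPs, fun p hp => ?_⟩
  have hp' := hsub hp
  rw [mem_filter, mem_Ioc] at hp'
  refine ⟨hp'.2, (Nat.floor_lt hx0.le).1 hp'.1.1, ?_⟩
  exact (Nat.le_floor_iff (by positivity)).1 hp'.1.2

/-- **A certified row of Table 6.1 (constant `C`).** If the kernel checker accepts
`rowCheck C k n₀ V l`, then for `1 ≤ N < R ≤ 2N`, `0 < u ≤ 1` and `N^{k-1} ≤ t ≤ N^k`:
`‖∑_{N<n≤R} (n+u)^{-it}‖ ≤ C · N^{1-(log N)²/(133.66 log² t)}`.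
[cite: Ford2002, Lemma 6.8 (Theorem 2 on `λ ∈ [k-1, k]`)] -/
theorem row_const {C k n₀ V : ℕ} {l : List Step} (h : rowCheck C k n₀ V l = true)
    {N R : ℕ} {t u : ℝ} (hN : 1 ≤ N) (hNR : N < R) (hR : R ≤ 2 * N) (hu0 : 0 < u) (hu1 : u ≤ 1)
    (ht1 : (N : ℝ) ^ (k - 1) ≤ t) (ht2 : t ≤ (N : ℝ) ^ k) :
    ‖∑ n ∈ Ioc N R, ((n : ℂ) + u) ^ (-(t * Complex.I))‖
      ≤ C * (N : ℝ) ^ (1 - Real.log N ^ 2 / (133.66 * Real.log t ^ 2)) := by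
  obtain ⟨hk4, hn₀, hn₀k, hkV, hV16, hV8, hwin, hok, hdc, hC⟩ := rowCheck_sound h
  have hrow := row_of_chain hk4 hn₀ hn₀k (η := 23 / 20) (by norm_num) (by norm_num) hkV hV16
    (fun _ hu _ hx => exists_prime_Icc_sylvester hu hx) (fun x hx => hwinV_sylvester hV8 hwin x hx) l hok
    hdc hN hNR hR hu0 hu1 ht1 ht2
  refine hrow.trans ?_
  exact mul_le_mul_of_nonneg_right hC (Real.rpow_nonneg (Nat.cast_nonneg _) _)

end FordVK
end Literature.NumberTheory.LFunctions
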